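import Mathlib
import Summits.ValiantsHypothesis.ValiantsHypothesis.Theses.ProofCarryingSymmetry
import Summits.ValiantsHypothesis.ValiantsHypothesis.Theorems.ProofCarryingSymmetryAssembly
import Summits.ValiantsHypothesis.ValiantsHypothesis.Theorems.ProofCarryingSymmetryRestorationQPInvarianceProofCalculus
import Summits.ValiantsHypothesis.ValiantsHypothesis.Theorems.ProofCarryingSymmetryRestorationQPDistStability

/-!
# Route ProofCarryingSymmetry — the per-line assembly: ANCHOR ∧ T_per ∧ L ⇒ Valiant's hypothesis

The route's foreseen glued edit (a) (route file, TWO-LAYER PLAN: "support PerLineAssembly :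
SquareSymmetricPermLB → StabilityOfProvableSymmetry → PerInvarianceProvableQP → ValiantsHypothesis …
RestorationQP then off the critical path"), kernel-checked now that every ingredient is typed:

* `valiantsHypothesis_of_perLine` — `SquareSymmetricPermLB → PerInvarianceProvableQP → L → VH` with
  L the birth stability statement (all-`σ` form; the adjacent-transposition proofs delivered by T_per
  are spread to all `σ ∈ S_n` by the word-length calculus `hasPCProofOfSize_rename_perm_of_adjacent`,
  a polynomial factor `2(n+1)²`);
* `valiantsHypothesis_of_perLine_dist` — the same with L replaced by the line's current bet S2⁗
  (`stub_proofsToDistEquiv`: distributivity elimination from invariance proofs up to AC + units +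
  constants of the unfolding), through the PROVED S3⁗ (`stabilityAtDistEquiv`).

So the route can be re-assembled on the items {SquareSymmetricPermLB (closed), PerInvarianceProvableQP
(stmt-10360), L (stmt-10358, to be typed as S2⁗ or as below)} — lead c2's recommendation after proving
`RestorationQP ⇒ T′` and reducing the line to the stability bet.  Everything proved, no named facts.
-/

-- single-problem summit: `Summit.ValiantsHypothesis.ValiantsHypothesis.…` is the namespace by design (D-0017)
set_option linter.dupNamespace false

namespace Summit.ValiantsHypothesis.ValiantsHypothesis.Theorems

open Literature.Computability.AlgebraicComplexity
open Summit.ValiantsHypothesis.ValiantsHypothesis.Theses.ProofCarryingSymmetry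

/-! ### Quasi-polynomial bookkeeping -/

/-- With `M = (log₂ n + c₁)^c₁`: `(2^M + 2^M + n + 2)^c₂ ≤ 2^((log₂ n + c)^c)` for `c = c₁ + c₂ + 3`.
[folklore] -/
theorem qp_absorb_two (c₁ c₂ : ℕ) : ∃ c : ℕ, ∀ n : ℕ,
    (2 ^ ((Nat.log 2 n + c₁) ^ c₁) + 2 ^ ((Nat.log 2 n + c₁) ^ c₁) + n + 2) ^ c₂ ≤
      2 ^ ((Nat.log 2 n + c) ^ c) := by
  refine ⟨c₁ + c₂ + 3, fun n => ?_⟩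
  have hn : n < 2 ^ (Nat.log 2 n + 1) := Nat.lt_pow_succ_log_self Nat.one_lt_two n
  generalize Nat.log 2 n = L at hn ⊢
  set M : ℕ := (L + c₁) ^ c₁ with hM
  set B : ℕ := L + (c₁ + c₂ + 3) with hB
  have h1 : 2 ^ M + 2 ^ M + n + 2 ≤ 2 ^ (M + L + 3) := by
    have hA : 2 ^ M ≤ 2 ^ (M + L + 1) := Nat.pow_le_pow_right (by norm_num) (by omega)
    have hL1 : 2 ^ (L + 1) ≤ 2 ^ (M + L + 1) := Nat.pow_le_pow_right (by norm_num) (by omega)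
    have h4 : 2 ^ (M + L + 3) = 2 ^ (M + L + 1) * 4 := by
      rw [show M + L + 3 = (M + L + 1) + 2 by omega, pow_add]; norm_num
    omega
  have h2 : (M + L + 3) * c₂ ≤ B ^ (c₁ + c₂ + 3) := by
    have hB1 : 1 ≤ B := by omega
    have hMB : M ≤ B ^ (c₁ + c₂ + 1) :=
      calc M = (L + c₁) ^ c₁ := hM
        _ ≤ B ^ c₁ := Nat.pow_le_pow_left (by omega) _
        _ ≤ B ^ (c₁ + c₂ + 1) := Nat.pow_le_pow_right hB1 (by omega)
    have hLB : L + 3 ≤ B ^ (c₁ + c₂ + 1) :=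
      calc L + 3 ≤ B := by omega
        _ = B ^ 1 := (pow_one B).symm
        _ ≤ B ^ (c₁ + c₂ + 1) := Nat.pow_le_pow_right hB1 (by omega)
    calc (M + L + 3) * c₂ ≤ (2 * B ^ (c₁ + c₂ + 1)) * B := Nat.mul_le_mul (by omega) (by omega)
      _ ≤ (B * B ^ (c₁ + c₂ + 1)) * B := Nat.mul_le_mul_right _ (Nat.mul_le_mul_right _ (by omega))
      _ = B ^ (c₁ + c₂ + 3) := by ring
  calc (2 ^ M + 2 ^ M + n + 2) ^ c₂ ≤ (2 ^ (M + L + 3)) ^ c₂ := Nat.pow_le_pow_left h1 _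
    _ = 2 ^ ((M + L + 3) * c₂) := (pow_mul 2 _ _).symm
    _ ≤ 2 ^ (B ^ (c₁ + c₂ + 3)) := Nat.pow_le_pow_right (by norm_num) h2

/-- The stability input stays quasi-polynomial: with `N = 2^((log₂ n + c)^c)`,
`N + 2(n+1)²(N + 2N) ≤ 2^((log₂ n + (c+6))^(c+6))`. [folklore] -/
theorem qp_spread (c n : ℕ) :
    2 ^ ((Nat.log 2 n + c) ^ c) + 2 * (n + 1) ^ 2 * (2 ^ ((Nat.log 2 n + c) ^ c) + 2 * 2 ^ ((Nat.log 2 n + c) ^ c)) ≤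
      2 ^ ((Nat.log 2 n + (c + 6)) ^ (c + 6)) := by
  have hn : n < 2 ^ (Nat.log 2 n + 1) := Nat.lt_pow_succ_log_self Nat.one_lt_two n
  generalize Nat.log 2 n = L at hn ⊢
  set M : ℕ := (L + c) ^ c with hM
  -- `1 + 6(n+1)² ≤ 2^(2L+5)`
  have h1 : (n + 1) ^ 2 ≤ 2 ^ (2 * L + 2) := by
    have : n + 1 ≤ 2 ^ (L + 1) := hn
    calc (n + 1) ^ 2 ≤ (2 ^ (L + 1)) ^ 2 := Nat.pow_le_pow_left this 2
      _ = 2 ^ (2 * L + 2) := by rw [← pow_mul]; ring_nf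
  have h2 : 1 + 6 * (n + 1) ^ 2 ≤ 2 ^ (2 * L + 5) := by
    have : 2 ^ (2 * L + 5) = 2 ^ (2 * L + 2) * 8 := by rw [show 2 * L + 5 = (2 * L + 2) + 3 by omega, pow_add]; norm_num
    have : 1 ≤ 2 ^ (2 * L + 2) := Nat.one_le_two_pow
    omega
  have h3 : 2 ^ M + 2 * (n + 1) ^ 2 * (2 ^ M + 2 * 2 ^ M) = 2 ^ M * (1 + 6 * (n + 1) ^ 2) := by ring
  rw [h3]
  have h4 : 2 ^ M * (1 + 6 * (n + 1) ^ 2) ≤ 2 ^ (M + (2 * L + 5)) := by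
    rw [pow_add]; exact Nat.mul_le_mul_left _ h2
  refine h4.trans (Nat.pow_le_pow_right (by norm_num) ?_)
  -- `M + 2L + 5 ≤ (L + c + 6)^(c+6)`
  have hA : M ≤ (L + (c + 6)) ^ c := Nat.pow_le_pow_left (by omega) _
  have hC : 2 * L + 6 ≤ (L + (c + 6)) ^ 5 := by
    have : 2 * L + 6 ≤ 2 * (L + (c + 6)) := by omega
    have h8 : 2 * (L + (c + 6)) ≤ (L + (c + 6)) * (L + (c + 6)) := Nat.mul_le_mul_right _ (by omega)
    have h9 : (L + (c + 6)) * (L + (c + 6)) = (L + (c + 6)) ^ 2 := by ring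
    have h10 : (L + (c + 6)) ^ 2 ≤ (L + (c + 6)) ^ 5 := Nat.pow_le_pow_right (by omega) (by norm_num)
    omega
  have h1' : 1 ≤ (L + (c + 6)) := by omega
  have e : (L + (c + 6)) ^ 6 = (L + (c + 6)) ^ 5 * (L + (c + 6)) := pow_succ _ 5
  have hp5 : 1 ≤ (L + (c + 6)) ^ 5 := Nat.one_le_pow _ _ h1'
  have hpc : 1 ≤ (L + (c + 6)) ^ c := Nat.one_le_pow _ _ h1'
  have hP1 : (L + (c + 6)) ^ c ≤ (L + (c + 6)) ^ c * (L + (c + 6)) ^ 5 := Nat.le_mul_of_pos_right _ hp5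
  have hP2 : (L + (c + 6)) ^ 5 ≤ (L + (c + 6)) ^ c * (L + (c + 6)) ^ 5 := Nat.le_mul_of_pos_left _ hpc
  have hfin : (L + (c + 6)) ^ c * (L + (c + 6)) ^ 5 * 2 ≤ (L + (c + 6)) ^ c * (L + (c + 6)) ^ 5 * (L + (c + 6)) :=
    Nat.mul_le_mul_left _ (by omega)
  calc M + (2 * L + 5) ≤ (L + (c + 6)) ^ c * (L + (c + 6)) ^ 5 * 2 := by omega
    _ ≤ (L + (c + 6)) ^ c * (L + (c + 6)) ^ 5 * (L + (c + 6)) := hfin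
    _ = (L + (c + 6)) ^ c * (L + (c + 6)) ^ 6 := by rw [e, Nat.mul_assoc]
    _ = (L + (c + 6)) ^ (c + 6) := by rw [← pow_add]

/-! ### The per-line assembly -/

/-- From T_per and the stability statement `hL` (all-`σ`, size-`t` form), quasi-polynomial
SYMMETRIC circuits for the permanent — the input of the anchor. [folklore] -/
theorem symmetricPerQP_of_perLine
    (hT : PerInvarianceProvableQP)
    (hL : ∃ c : ℕ, ∀ (n t : ℕ) (C : PICircuit ℂ (Fin n × Fin n)),
      (∀ σ : Equiv.Perm (Fin n), HasPCProofOfSize (C.rename fun x : Fin n × Fin n => σ • x) C t) →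
      ∃ (G : Type) (_ : Fintype G) (D : LabelledArithCircuit ℂ (Fin n × Fin n) Unit G),
        D.IsSymmetric (Equiv.Perm (Fin n)) ∧ D.eval (D.output ()) = C.eval ∧ Fintype.card G ≤ (C.size + t + n + 2) ^ c)
    (hVP : IsVPFamily fun n => perPoly (Fin n) ℂ) :
    ∃ c : ℕ, ∀ n : ℕ, ∃ (G : Type) (_ : Fintype G) (D : LabelledArithCircuit ℂ (Fin n × Fin n) Unit G),
      D.IsSymmetric (Equiv.Perm (Fin n)) ∧ D.eval (D.output ()) = perPoly (Fin n) ℂ ∧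
      Fintype.card G ≤ 2 ^ ((Nat.log 2 n + c) ^ c) := by
  obtain ⟨c, hc⟩ := hT hVP
  obtain ⟨cL, hcL⟩ := hL
  obtain ⟨c', hc'⟩ := qp_absorb_two (c + 6) cL
  refine ⟨c', fun n => ?_⟩
  obtain ⟨C, hev, hsize, hadj⟩ := hc n
  set N := 2 ^ ((Nat.log 2 n + c) ^ c) with hN
  -- all `σ` from the adjacent transpositions
  have hall : ∀ σ : Equiv.Perm (Fin n), HasPCProofOfSize (C.rename fun x : Fin n × Fin n => σ • x) C
      (2 * (n + 1) ^ 2 * (N + 2 * N)) := by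
    intro σ
    refine (hasPCProofOfSize_rename_perm_of_adjacent N C (fun i j hij => ?_) σ).mono ?_
    · obtain ⟨i, hi⟩ := i
      obtain ⟨j, hj⟩ := j
      simp only at hij
      subst hij
      exact hadj i hj
    · exact Nat.mul_le_mul_left _ (by omega)
  obtain ⟨G, hG, D, hsym, hDev, hcard⟩ := hcL n _ C hall
  refine ⟨G, hG, D, hsym, hDev.trans hev, hcard.trans ?_⟩
  have hsp := qp_spread c n
  rw [← hN] at hsp
  calc (C.size + 2 * (n + 1) ^ 2 * (N + 2 * N) + n + 2) ^ cL
      ≤ (2 ^ ((Nat.log 2 n + (c + 6)) ^ (c + 6)) + 2 ^ ((Nat.log 2 n + (c + 6)) ^ (c + 6)) + n + 2) ^ cL := by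
        apply Nat.pow_le_pow_left
        have : C.size + 2 * (n + 1) ^ 2 * (N + 2 * N) ≤ 2 ^ ((Nat.log 2 n + (c + 6)) ^ (c + 6)) :=
          (Nat.add_le_add_right hsize _).trans hsp
        have : 0 ≤ 2 ^ ((Nat.log 2 n + (c + 6)) ^ (c + 6)) := Nat.zero_le _
        omega
    _ ≤ 2 ^ ((Nat.log 2 n + c') ^ c') := hc' n

/-- **The per-line assembly** (route edit (a)): `SquareSymmetricPermLB → PerInvarianceProvableQP → L →
ValiantsHypothesis`, with L the birth stability statement (all-`σ`, size-`t` proofs ⇒ a symmetric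
circuit of size polynomial in `|C| + t + n`).  Were `VP = VNP`, `per` would be a VP family (hub
lemma); T_per and L give quasi-polynomial symmetric circuits for `per_n` (`symmetricPerQP_of_perLine`),
contradicting Dawar–Wilsenach (`natLog_add_pow_lt_mul_eventually`). [folklore] -/
theorem valiantsHypothesis_of_perLine : Summit.ValiantsHypothesis.ValiantsHypothesis.Theses.ProofCarryingSymmetry.SquareSymmetricPermLB → Summit.ValiantsHypothesis.ValiantsHypothesis.Theses.ProofCarryingSymmetry.PerInvarianceProvableQP → (∃ c : ℕ, ∀ (n t : ℕ) (C : PICircuit ℂ (Fin n × Fin n)), (∀ σ : Equiv.Perm (Fin n), HasPCProofOfSize (C.rename fun x : Fin n × Fin n => σ • x) C t) → ∃ (G : Type) (_ : Fintype G) (D : LabelledArithCircuit ℂ (Fin n × Fin n) Unit G), D.IsSymmetric (Equiv.Perm (Fin n)) ∧ D.eval (D.output ()) = C.eval ∧ Fintype.card G ≤ (C.size + t + n + 2) ^ c) → ValiantsHypothesis := by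
  intro hLB hT hL
  refine Summit.ValiantsHypothesis.Hub.valiantsHypothesis_of_not_isVPFamily_per ?_
    (mem_VP_ofFintype_iff_holds _) (perFamily_mem_VNP_holds ℂ)
  intro hVP
  obtain ⟨c, hc⟩ := symmetricPerQP_of_perLine hT hL hVP
  choose G hG C hsym heval hcard using hc
  obtain ⟨ε, hε, hio⟩ := @hLB G hG C hsym heval
  obtain ⟨n₀, hn₀⟩ := Summit.ValiantsHypothesis.Theorems.ProofCarryingSymmetry.natLog_add_pow_lt_mul_eventually c hε
  obtain ⟨n, hn, hle⟩ := hio n₀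
  have h1 : (Fintype.card (G n) : ℝ) ≤ (2 : ℝ) ^ (((Nat.log 2 n + c) ^ c : ℕ) : ℝ) := by
    rw [Real.rpow_natCast]
    exact_mod_cast hcard n
  have h2 : ε * n ≤ (((Nat.log 2 n + c) ^ c : ℕ) : ℝ) :=
    (Real.rpow_le_rpow_left_iff one_lt_two).1 (hle.trans h1)
  exact absurd (hn₀ n hn) (not_lt.2 h2)

/-- **The per-line assembly on the line's current bet** S2⁗ (`stub_proofsToDistEquiv`:
distributivity elimination from invariance proofs, up to AC + units + constants of the unfolding),
through the PROVED S3⁗ (`stabilityAtDistEquiv`): `SquareSymmetricPermLB → PerInvarianceProvableQP →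
S2⁗ → ValiantsHypothesis`. [folklore] -/
theorem valiantsHypothesis_of_perLine_dist
    (hLB : SquareSymmetricPermLB) (hT : PerInvarianceProvableQP)
    (hS : ∃ c : ℕ, ∀ (n t : ℕ) (C : PICircuit ℂ (Fin n × Fin n)),
      (∀ σ : Equiv.Perm (Fin n), HasPCProofOfSize (C.rename fun x : Fin n × Fin n => σ • x) C t) →
      ∃ C' : PICircuit ℂ (Fin n × Fin n), C'.eval = C.eval ∧ C'.size ≤ (C.size + t + n + 2) ^ c ∧
        ∀ σ : Equiv.Perm (Fin n), (pfSystem ℂ (Fin n × Fin n)).Provable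
          (C'.rename fun x : Fin n × Fin n => σ • x).unfold C'.unfold ⊤ (fun s => if s = PIAxiom.A6 then 0 else ⊤)) :
    _root_.ValiantsHypothesis := by
  refine valiantsHypothesis_of_perLine hLB hT ?_
  obtain ⟨c₂, h₂⟩ := hS
  obtain ⟨c₃, h₃⟩ := stabilityAtDistEquiv
  refine ⟨(c₂ + 2) * c₃, fun n t C hC => ?_⟩
  obtain ⟨C', hC'eval, hC'size, hC'pf⟩ := h₂ n t C hC
  obtain ⟨G, hG, D, hDsym, hDeval, hDcard⟩ := h₃ n C' hC'pf
  refine ⟨G, hG, D, hDsym, hDeval.trans hC'eval, ?_⟩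
  calc Fintype.card G ≤ (C'.size + n + 2) ^ c₃ := hDcard
    _ ≤ ((C.size + t + n + 2) ^ c₂ + n + 2) ^ c₃ := Nat.pow_le_pow_left (by omega) _
    _ ≤ (C.size + t + n + 2) ^ ((c₂ + 2) * c₃) := ACStability.poly_absorb' c₂ c₃ _ t n C.one_le_size

end Summit.ValiantsHypothesis.ValiantsHypothesis.Theorems
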